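import Mathlib
import HarnessLib
import Summits.CriticalPhenomena.PercolationContinuityZ3.Theses.PercTreeValue
import Literature.Probability.Percolation.TreeGraphBoundFour
import Literature.Probability.Percolation.TwoPointFunction
import Literature.Probability.Percolation.PercolationProofs

/-!
# Crux `TetrahedronHarrisGap` (stmt-CriticalPhenomena-7799): the four-point split `H = Ψ + d`

Lead prover-line-stmt-CriticalPhenomena-7799-c2-0 (line `SketchIdeator1`, continuation c2).  Glue for planners who re-line the crux.
With `A = {0 ↔ a_r}`, `B = {b_r ↔ c_r}` (`a_r = (r,r,0)`, `b_r = (r,0,r)`, `c_r = (0,r,r)`), `P = P_{p_c(ℤ³)}`, `τ_A = τ(0,a_r)`,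
`τ_B = τ(b_r,c_r)`, the Harris ratio `H_r = P(A ∩ B)/(τ_A τ_B)` splits EXACTLY as `H = Ψ + d` with
`Ψ_r = P(0, a_r, b_r, c_r all connected)/(τ_A τ_B)` (four-point amplitude) and `d_r = P(A ∩ B ∩ {0 ↮ b_r})/(τ_A τ_B)` (the
disjoint-coexistence amplitude of the rank-2 crux `TetrahedronDisjointCoexistence`):

* `measureReal_openConn_inter_eq_add` : `P(A ∩ B) = P(openConn₄ 0 b a c) + P(A ∩ B ∩ (openConn 0 b)ᶜ)` (any graph, any `p`);
* `crux_of_fourPointGap` : a uniform four-point gap `(1+δ) τ_A τ_B ≤ P(openConn₄ 0 b_r a_r c_r)` implies the crux (`d ≥ 0`);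
* `crux_of_disjointCoexistence_of_fourPointFloor` : `TetrahedronDisjointCoexistence` (with its `δ`) together with the four-point
  floor `liminf Ψ_r ≥ 1` (`∀ ε > 0`, eventually `(1 − ε) τ_A τ_B ≤ P(openConn₄ 0 b_r a_r c_r)`) implies the crux with `δ/2`.

Numerically (route pilot MC, L ≤ 96, r ≤ 12): `H* ≈ 1.46`, `Ψ* ≈ 1.30`, `d* ≈ 0.15`.  Harris gives only `Ψ + d ≥ 1`, BK only `d ≤ 1`;
above six dimensions `Ψ → 0` and `d → 1`, in a jump world `Ψ → 1` and `d → 0` — so neither hypothesis of the third theorem is soft.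
Sorry-free; no definitions; all ℤ³ inputs are hypotheses.
-/

noncomputable section

open MeasureTheory Set
open Literature.Probability.Percolation Literature.Probability.LatticeModels

namespace Summit.CriticalPhenomena.PercolationContinuityZ3.Theorems.TetrahedronHarrisGap

variable {V : Type*}

/-- `{x₁, x₂, y₁, y₂ all connected} = {x₁ ↔ y₁} ∩ {x₂ ↔ y₂} ∩ {x₁ ↔ x₂}` (transitivity of `↔`). [folklore] -/
theorem openConn₄_eq_inter_inter (x₁ x₂ y₁ y₂ : V) :
    (openConn₄ x₁ x₂ y₁ y₂ : Set (BondConfig V)) = openConn x₁ y₁ ∩ openConn x₂ y₂ ∩ openConn x₁ x₂ := by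
  ext ω
  rw [mem_openConn₄]
  simp only [mem_inter_iff]
  constructor
  · rintro ⟨h12, h11, h1y2⟩
    exact ⟨⟨h11, h12.symm.trans h1y2⟩, h12⟩
  · rintro ⟨⟨h11, h22⟩, h12⟩
    exact ⟨h12, h11, h12.trans h22⟩

/-- `{all four connected} ⊆ {x₁ ↔ y₁} ∩ {x₂ ↔ y₂}`. [folklore] -/
theorem openConn₄_subset_openConn_inter (x₁ x₂ y₁ y₂ : V) :
    (openConn₄ x₁ x₂ y₁ y₂ : Set (BondConfig V)) ⊆ openConn x₁ y₁ ∩ openConn x₂ y₂ := by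
  rw [openConn₄_eq_inter_inter]
  exact inter_subset_left

/-- **The split `H = Ψ + d`** (event/measure form, any countable graph, any `p`):
`P({x₁ ↔ y₁} ∩ {x₂ ↔ y₂}) = P(x₁,x₂,y₁,y₂ all connected) + P({x₁ ↔ y₁} ∩ {x₂ ↔ y₂} ∩ {x₁ ↮ x₂})` — two connected pairs lie either
in one common cluster or in two different clusters. [cite: Aizenman1997, §5 Lemma 4 (4.10) (the dichotomy behind the truncation bound)] -/
theorem measureReal_openConn_inter_eq_add [Countable V] (G : SimpleGraph V) (p : unitInterval) (x₁ y₁ x₂ y₂ : V) :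
    (bondPercolation G p).real (openConn x₁ y₁ ∩ openConn x₂ y₂) =
      (bondPercolation G p).real (openConn₄ x₁ x₂ y₁ y₂) +
        (bondPercolation G p).real (openConn x₁ y₁ ∩ openConn x₂ y₂ ∩ (openConn x₁ x₂)ᶜ) := by
  rw [openConn₄_eq_inter_inter, ← Set.sdiff_eq]
  exact (measureReal_inter_add_sdiff (μ := bondPercolation G p) (s := openConn x₁ y₁ ∩ openConn x₂ y₂)
    (measurableSet_openConn_holds x₁ x₂)).symm

/-- **crux ⟸ four-point gap.** If the four-point connectivity of the critical tetrahedron exceeds the Harris product of the two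
opposite edges by a uniform factor, `(1+δ) τ(0,a_r) τ(b_r,c_r) ≤ P_{p_c}(0, b_r, a_r, c_r all connected)` for `r ≥ r₀`, then
`TetrahedronHarrisGap` holds with the same `δ` (`{all four connected} ⊆ {0 ↔ a_r} ∩ {b_r ↔ c_r}`). -/
theorem crux_of_fourPointGap :
    (∃ δ : ℝ, 0 < δ ∧ ∃ r₀ : ℕ, ∀ r : ℕ, r₀ ≤ r →
      (1 + δ) * tau 3 (criticalProbI 3) 0 ![(r : ℤ), (r : ℤ), 0] *
          tau 3 (criticalProbI 3) ![(r : ℤ), 0, (r : ℤ)] ![0, (r : ℤ), (r : ℤ)] ≤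
        (bondPercolation (zdGraph 3) (criticalProbI 3)).real
          (openConn₄ (0 : Site 3) ![(r : ℤ), 0, (r : ℤ)] ![(r : ℤ), (r : ℤ), 0] ![0, (r : ℤ), (r : ℤ)])) →
    Summit.CriticalPhenomena.PercolationContinuityZ3.Theses.PercTreeValue.TetrahedronHarrisGap := by
  rintro ⟨δ, hδ, r₀, h⟩
  unfold Summit.CriticalPhenomena.PercolationContinuityZ3.Theses.PercTreeValue.TetrahedronHarrisGap
  refine ⟨δ, hδ, r₀, fun r hr => (h r hr).trans ?_⟩
  exact measureReal_mono (openConn₄_subset_openConn_inter _ _ _ _)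

/-- **crux ⟸ disjoint coexistence ∧ four-point floor.** If `TetrahedronDisjointCoexistence` holds (constant `δ`) and the
four-point amplitude does not fall below the Harris product asymptotically (`∀ ε > 0`, eventually
`(1 − ε) τ(0,a_r) τ(b_r,c_r) ≤ P_{p_c}(0, b_r, a_r, c_r all connected)`), then `H = Ψ + d ≥ (1 − δ/2) + δ`, i.e.
`TetrahedronHarrisGap` holds with `δ/2`. -/
theorem crux_of_disjointCoexistence_of_fourPointFloor :
    Summit.CriticalPhenomena.PercolationContinuityZ3.Theses.PercTreeValue.TetrahedronDisjointCoexistence →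
    (∀ ε : ℝ, 0 < ε → ∃ r₀ : ℕ, ∀ r : ℕ, r₀ ≤ r →
      (1 - ε) * tau 3 (criticalProbI 3) 0 ![(r : ℤ), (r : ℤ), 0] *
          tau 3 (criticalProbI 3) ![(r : ℤ), 0, (r : ℤ)] ![0, (r : ℤ), (r : ℤ)] ≤
        (bondPercolation (zdGraph 3) (criticalProbI 3)).real
          (openConn₄ (0 : Site 3) ![(r : ℤ), 0, (r : ℤ)] ![(r : ℤ), (r : ℤ), 0] ![0, (r : ℤ), (r : ℤ)])) →
    Summit.CriticalPhenomena.PercolationContinuityZ3.Theses.PercTreeValue.TetrahedronHarrisGap := by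
  intro hD hΨ
  unfold Summit.CriticalPhenomena.PercolationContinuityZ3.Theses.PercTreeValue.TetrahedronDisjointCoexistence at hD
  unfold Summit.CriticalPhenomena.PercolationContinuityZ3.Theses.PercTreeValue.TetrahedronHarrisGap
  obtain ⟨δ, hδ, r₁, hD⟩ := hD
  obtain ⟨r₂, hΨ⟩ := hΨ (δ / 2) (by positivity)
  refine ⟨δ / 2, by positivity, max r₁ r₂, fun r hr => ?_⟩
  have h1 := hD r ((le_max_left _ _).trans hr)
  have h2 := hΨ r ((le_max_right _ _).trans hr)
  rw [measureReal_openConn_inter_eq_add]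
  linarith

end Summit.CriticalPhenomena.PercolationContinuityZ3.Theorems.TetrahedronHarrisGap

end
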